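import Summits.RiemannHypothesis.RiemannHypothesis.Theorems.HandoffWallSequence
import Summits.RiemannHypothesis.RiemannHypothesis.Theorems.HandoffMarginLaw
import Summits.RiemannHypothesis.RiemannHypothesis.Theorems.HandoffUpperClauses
import HarnessLib

/-!
# WALL MOTION and the MARGIN DOOR: RH iff infinitely many primes move the semi-local wall; a margin law implies RH
# exactly when it forces unbounded walls — the sign of the margin is immaterial (cell `rh-explicit`, TRACK «HANDOFF», file XIII)

Seat handoff-theory-1 (H-T, statement owner), gen6.  Companion text `HOME/handoff/HANDOFF-STATEMENT.md` §J.16.  Corollaries of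
file XII (`HandoffWallSequence`: the freeze `W(N) = a₀` past the failing prime; `RH ↔` walls unbounded) in two currencies the
cell uses — «does the prime `q` move the wall?» and theory-2's typed slot E-1 `HandoffMargin m` (`MARGIN-LAW.md`).  KERNEL
bookkeeping, no new analysis; nothing here is a step towards RH.  `W(N) := a*({p < N}) = weilSemilocalThreshold (Nat.primesBelow N)`.

* §1 WALL MOTION.  A prime `q` MOVES the wall if `W(q) ≠ W(q⁺)` (`S_{q⁺} = S_q ∪ {q}`).  Under a failed increment at `q₁` no prime
  `> q₁` moves the wall (`wall_eq_wall_nextPrime_of_not_handoffStep`); between primes the wall never moves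
  (`wall_succ_eq_of_not_prime`, `wall_nextPrime_eq_wall_succ`); hence **`riemannHypothesis_iff_wall_moves_io : RH ↔ ∀ Q, ∃ prime
  q ≥ Q, W(q) ≠ W(q⁺)`** — RH iff INFINITELY MANY primes move the wall, `¬RH` iff only finitely many do (both directions, no
  upper clause needed); `riemannHypothesis_of_forall_wall_lt` (every prime raises the wall ⟹ RH) and, under the RH-free upper
  clause at every prime, `RH ↔ ∀ q prime, W(q) < W(q⁺)` (`riemannHypothesis_iff_forall_wall_lt_of_upperClause`).
* §2 THE MARGIN DOOR (slot E-1).  Under `¬RH` the wall offsets are eventually AFFINE: `δ*(q) = a₀ − (log q)/2` for every prime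
  `q > q₁` (`wallOffset_eq_of_not_handoffStep`), so `δ* → −∞`.  Hence **`riemannHypothesis_iff_wallOffset_bddBelow :
  RH ↔ ∃ C, ∀ q prime, C ≤ δ*(q)`**; **`handoffMargin_const_iff : ∀ c ≤ 0, MARGIN(c) ↔ RH`** (theory-2's
  `handoffMargin_zero_iff` is the case `c = 0`; a NEGATIVE uniform margin is already RH); and the exact size of the door:
  **`riemannHypothesis_of_handoffMargin_of_unbounded` — `MARGIN(m) ⟹ RH` whenever `q ↦ m(q) + (log q)/2` is unbounded above along
  the primes** (e.g. `m(q) = −0.49·log q`), sharpening `riemannHypothesis_of_handoffMargin` (`m ≥ 0`).  READING for conj-1: the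
  RH-content of ANY threshold-margin law is exactly «the walls are unbounded»; the sign and size of `m` carry no additional
  logical weight toward RH (they are DATA about individual primes).
* §3 INSTANCES (kernel, unconditional): the primes `2` and `3` MOVE the wall — `a*(∅) < a*({2}) < a*({2,3})`
  (`wall_two_lt_wall_three`, `wall_three_lt_wall_five`; theory-2's kernel upper clauses `HandoffUpperClauses` + the theorem rungs
  `handoffH_two`, `handoffH_three`).  So: AT LEAST TWO primes move the wall (THEOREM), under `¬RH` at most FINITELY MANY do, and RH
  iff INFINITELY MANY do; `5` moves the wall iff `a*({2,3}) < a*({2,3,5})`, which is CERTIFIED data (H(5)), not yet a theorem.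
* §4 WHAT A MOVING PRIME CERTIFIES (appended, same gen): `wall_eq_wall_nextPrime_of_not_weilPositivityOn` (below a failed rung no prime
  moves the wall) and **`weilPositivityOn_of_wall_ne : W(q) ≠ W(q⁺) → WeilPositivityOn((log q)/2)`** — RH-free: a prime that moves the wall
  carries the RUNG at its own entrance (`IH(q)`), so «q moves the wall» is CUMULATIVE in the sense of HANDOFF-STATEMENT §I.5 (instances are at
  least rung-strength; `handoffH_of_wall_ne_nextPrime`), while it is NOT known to be RH-implied without `UC(q)` — only its infinitude is RH.
* §5 TAIL FORMS UNDER AN EVENTUAL UPPER CLAUSE (appended, theory-1 gen8). The cell now has an RH-free route to the upper clause FROM SOME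
  PRIME ON — prove-2's `HandoffDodgerUpperClause.upperClause_eventually_of_dodgerWallCeiling` derives `∀ q ≥ Q prime, W(q) < (log q⁺)/2` from
  the typed exponent-3/2 target `HandoffDodgerCeiling.DodgerWallCeiling C q₀` (ATTEMPT-15: DERIVED-MODEL there, cells certified prime by prime
  by cc-s2-6 — labels theirs; not a theorem), and `HandoffWallCeiling.wall_lt_log_half_of_large_gap` gives it behind Cramér-size gaps. This
  section records what such a TAIL upper clause (a named hypothesis here, from an arbitrary `Q`) does to §1: the rate-free «RH ↔ infinitely
  many primes move the wall» sharpens to **`riemannHypothesis_iff_forall_ge_wall_ne_of_upperClause : RH ↔ every prime q ≥ Q moves the wall`**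
  (indeed strictly raises it, `riemannHypothesis_iff_forall_ge_wall_lt_of_upperClause`); the direction «every prime ≥ Q moves the wall ⟹ RH»
  needs no upper clause (`riemannHypothesis_of_forall_ge_wall_ne`); and under `¬RH` with failing prime `q₁` the movers `≥ Q` are exactly the
  primes in `[Q, q₁)`, the failing prime itself undecided (`wall_lt_wall_nextPrime_of_lt_of_not_handoffStep` with §1's
  `wall_eq_wall_nextPrime_of_not_handoffStep`). Bookkeeping only: the eventual-motion statement is RH itself modulo an RH-free tail upper
  clause, not a weaker target.

References: H. Yoshida, Adv. Stud. Pure Math. 21 (1992), Prop. 6 p. 320 (`Yoshida1992HermitianForms`); E. Bombieri, Rend. Mat. Acc.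
Lincei (9) 11 (2000), Thm 2 (`Bombieri2000Weil`).  Statements about the tree's objects; labelled PROVED-new, not literature.
-/

set_option linter.dupNamespace false  -- the mandated namespace repeats `RiemannHypothesis`

noncomputable section

open Set Filter Literature.NumberTheory.LFunctions
open Summit.RiemannHypothesis.RiemannHypothesis.Theorems.MotivicDoor.Semilocal
open Summit.RiemannHypothesis.RiemannHypothesis.Theorems.MotivicDoor.SemilocalThreshold
open Summit.RiemannHypothesis.RiemannHypothesis.Theorems.HandoffMarginLaw
open Summit.RiemannHypothesis.RiemannHypothesis.Theorems.HandoffLadderTheoremRungs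
open Summit.RiemannHypothesis.RiemannHypothesis.Theorems.HandoffUpperClauses
open scoped Topology

namespace Summit.RiemannHypothesis.RiemannHypothesis.Theorems.HandoffDecomposition

variable {q q₁ N : ℕ} {m : ℕ → ℝ} {c : ℝ}

/-! ## §1 Wall motion -/

/-- Between a prime `q` and its successor no prime appears: `{p < q⁺} = {p < q + 1}`. [folklore] -/
theorem primesBelow_nextPrime_eq (q : ℕ) : Nat.primesBelow (nextPrime q) = Nat.primesBelow (q + 1) := by
  ext p
  simp only [Nat.mem_primesBelow]
  constructor
  · rintro ⟨hp, hpp⟩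
    refine ⟨Nat.lt_succ_of_le ?_, hpp⟩
    by_contra hlt
    exact absurd (nextPrime_le hpp (not_le.1 hlt)) (not_le.2 hp)
  · rintro ⟨hp, hpp⟩
    exact ⟨lt_of_le_of_lt (Nat.le_of_lt_succ hp) (lt_nextPrime q), hpp⟩

/-- A non-prime `N` does not move the wall: `W(N+1) = W(N)`. [folklore] -/
theorem wall_succ_eq_of_not_prime (hN : ¬ N.Prime) :
    weilSemilocalThreshold (Nat.primesBelow (N + 1)) = weilSemilocalThreshold (Nat.primesBelow N) := by
  congr 1
  ext p
  simp only [Nat.mem_primesBelow]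
  constructor
  · rintro ⟨hp, hpp⟩
    refine ⟨lt_of_le_of_ne (Nat.le_of_lt_succ hp) ?_, hpp⟩
    rintro rfl
    exact hN hpp
  · rintro ⟨hp, hpp⟩
    exact ⟨Nat.lt_succ_of_lt hp, hpp⟩

/-- `W(q⁺) = W(q+1)`: the wall after `q` is the wall of `{p ≤ q}`. [folklore] -/
theorem wall_nextPrime_eq_wall_succ (q : ℕ) :
    weilSemilocalThreshold (Nat.primesBelow (nextPrime q)) = weilSemilocalThreshold (Nat.primesBelow (q + 1)) := by
  rw [primesBelow_nextPrime_eq]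

/-- **Past a failed increment no prime moves the wall**: `¬H′(q₁) → q₁ < q → W(q) = W(q⁺)` (both are `a₀`).
[this track (theory-1); Yoshida1992HermitianForms, Prop. 6 (p. 320)] -/
theorem wall_eq_wall_nextPrime_of_not_handoffStep (hq₁ : q₁.Prime) (hfail : ¬ HandoffStep q₁) (h : q₁ < q) :
    weilSemilocalThreshold (Nat.primesBelow q) = weilSemilocalThreshold (Nat.primesBelow (nextPrime q)) := by
  rw [wall_eq_threshold_of_not_handoffStep hq₁ hfail h,
    wall_eq_threshold_of_not_handoffStep hq₁ hfail (h.trans (lt_nextPrime q))]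

/-- If no prime `≥ Q` moves the wall, the wall sequence is constant from `Q` on. [this track (theory-1)] -/
theorem wall_eq_of_forall_prime_ge (Q : ℕ)
    (h : ∀ q ≥ Q, q.Prime →
      weilSemilocalThreshold (Nat.primesBelow q) = weilSemilocalThreshold (Nat.primesBelow (nextPrime q))) :
    ∀ N ≥ Q, weilSemilocalThreshold (Nat.primesBelow N) = weilSemilocalThreshold (Nat.primesBelow Q) := by
  intro N hN
  induction N, hN using Nat.le_induction with
  | base => rfl
  | succ N hQN ih =>
    rw [← ih]
    by_cases hp : N.Prime
    · rw [← wall_nextPrime_eq_wall_succ, ← h N hQN hp]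
    · exact wall_succ_eq_of_not_prime hp

/-- **RH ⟺ INFINITELY MANY PRIMES MOVE THE WALL** (`↔ ∀ Q, ∃ prime q ≥ Q, W(q) ≠ W(q⁺)`).  (⇒) otherwise the wall sequence is
eventually constant, excluded under RH by file XII; (⇐) under `¬RH` no prime beyond the failing one moves the wall.
No upper clause is needed in either direction. [this track (theory-1); Yoshida1992HermitianForms, Prop. 6 (p. 320); Bombieri2000Weil, Thm. 2] -/
theorem riemannHypothesis_iff_wall_moves_io :
    Summit.RiemannHypothesis ↔
      ∀ Q : ℕ, ∃ q ≥ Q, q.Prime ∧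
        weilSemilocalThreshold (Nat.primesBelow q) ≠ weilSemilocalThreshold (Nat.primesBelow (nextPrime q)) := by
  constructor
  · intro hRH Q
    by_contra hcon
    push Not at hcon
    have hconst := wall_eq_of_forall_prime_ge Q fun q hq hqp ↦ hcon q hq hqp
    exact riemannHypothesis_iff_not_wall_eventuallyConst.1 hRH ⟨_, Q, hconst⟩
  · intro h
    by_contra hRH
    obtain ⟨q₁, hq₁, hfail⟩ := exists_not_handoffStep_of_not_riemannHypothesis hRH
    obtain ⟨q, hq, hqp, hne⟩ := h (q₁ + 1)
    exact hne (wall_eq_wall_nextPrime_of_not_handoffStep hq₁ hfail (Nat.lt_of_succ_le hq))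

/-- Under `¬RH` only finitely many primes move the wall (all of them `≤` the failing prime). [this track (theory-1)] -/
theorem exists_forall_wall_eq_wall_nextPrime_of_not_riemannHypothesis (hRH : ¬ Summit.RiemannHypothesis) :
    ∃ q₁ : ℕ, q₁.Prime ∧ ¬ HandoffStep q₁ ∧ ∀ q : ℕ, q₁ < q →
      weilSemilocalThreshold (Nat.primesBelow q) = weilSemilocalThreshold (Nat.primesBelow (nextPrime q)) := by
  obtain ⟨q₁, hq₁, hfail⟩ := exists_not_handoffStep_of_not_riemannHypothesis hRH
  exact ⟨q₁, hq₁, hfail, fun q hq ↦ wall_eq_wall_nextPrime_of_not_handoffStep hq₁ hfail hq⟩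

/-- **Every prime raises the wall ⟹ RH** (indeed «infinitely many primes move it» suffices). [this track (theory-1)] -/
theorem riemannHypothesis_of_forall_wall_lt
    (h : ∀ q : ℕ, q.Prime →
      weilSemilocalThreshold (Nat.primesBelow q) < weilSemilocalThreshold (Nat.primesBelow (nextPrime q))) :
    Summit.RiemannHypothesis := by
  refine riemannHypothesis_iff_wall_moves_io.2 fun Q ↦ ?_
  obtain ⟨q, hQq, hq⟩ := Nat.exists_infinite_primes Q
  exact ⟨q, hQq, hq, (h q hq).ne⟩

/-- Under the RH-free UPPER clause at every prime (`a*(S_q) < (log q⁺)/2`; CERTIFIED data `5 ≤ q ≤ 73`, kernel `q ≤ 13`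
(`HandoffUpperClauses`), OPEN beyond — a named hypothesis), **RH ↔ every prime strictly raises the wall**. [this track (theory-1)] -/
theorem riemannHypothesis_iff_forall_wall_lt_of_upperClause
    (hUC : ∀ q : ℕ, q.Prime → weilSemilocalThreshold (Nat.primesBelow q) < Real.log (nextPrime q) / 2) :
    Summit.RiemannHypothesis ↔
      ∀ q : ℕ, q.Prime →
        weilSemilocalThreshold (Nat.primesBelow q) < weilSemilocalThreshold (Nat.primesBelow (nextPrime q)) :=
  ⟨fun hRH q hq ↦ wall_lt_wall_nextPrime_of_upperClause hq (hUC q hq) (riemannHypothesis_iff_forall_handoffH.1 hRH q hq),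
    riemannHypothesis_of_forall_wall_lt⟩

/-! ## §2 The margin door (slot E-1 `HandoffMargin`) -/

/-- **Under a failed increment the wall offsets are eventually AFFINE**: `¬H′(q₁) → q₁ < q → δ*(q) = a₀ − (log q)/2`.
[this track (theory-1); Yoshida1992HermitianForms, Prop. 6 (p. 320)] -/
theorem wallOffset_eq_of_not_handoffStep (hq₁ : q₁.Prime) (hfail : ¬ HandoffStep q₁) (h : q₁ < q) :
    wallOffset q = weilPositivityThreshold - Real.log q / 2 := by
  rw [wallOffset, wall_eq_threshold_of_not_handoffStep hq₁ hfail h]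

/-- Under a failed increment at `q₁`, the offset of any prime `q > max q₁ (e^{2(a₀ − C)})` is `< C`. [this track (theory-1)] -/
theorem wallOffset_lt_of_not_handoffStep (hq₁ : q₁.Prime) (hfail : ¬ HandoffStep q₁) (h : q₁ < q)
    (hC : Real.exp (2 * (weilPositivityThreshold - c)) < q) : wallOffset q < c := by
  rw [wallOffset_eq_of_not_handoffStep hq₁ hfail h]
  have h0 : (0 : ℝ) < q := (Real.exp_pos _).trans hC
  have h1 : 2 * (weilPositivityThreshold - c) < Real.log q := by
    rw [Real.lt_log_iff_exp_lt h0]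
    exact hC
  linarith

/-- **`RH ↔ THE WALL OFFSETS ARE BOUNDED BELOW`** (`∃ C, ∀ q prime, C ≤ δ*(q)`): under `¬RH` they are eventually
`a₀ − (log q)/2 → −∞`; under RH they are `≥ 0`.  The wall-language twin of the tree's `riemannHypothesis_iff_weilGroundEnergy_bddBelow`.
[this track (theory-1); Yoshida1992HermitianForms, Prop. 6 (p. 320); Bombieri2000Weil, Thm. 2] -/
theorem riemannHypothesis_iff_wallOffset_bddBelow :
    Summit.RiemannHypothesis ↔ ∃ C : ℝ, ∀ q : ℕ, q.Prime → C ≤ wallOffset q := by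
  constructor
  · intro hRH
    exact ⟨0, riemannHypothesis_iff_forall_wallOffset_nonneg.1 hRH⟩
  · rintro ⟨C, hC⟩
    by_contra hRH
    obtain ⟨q₁, hq₁, hfail⟩ := exists_not_handoffStep_of_not_riemannHypothesis hRH
    obtain ⟨q, hQq, hq⟩ :=
      Nat.exists_infinite_primes (max (q₁ + 1) (⌈Real.exp (2 * (weilPositivityThreshold - C))⌉₊ + 1))
    have h1 : q₁ < q := Nat.lt_of_succ_le ((le_max_left _ _).trans hQq)
    have h2 : Real.exp (2 * (weilPositivityThreshold - C)) < q := by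
      have h3 : ⌈Real.exp (2 * (weilPositivityThreshold - C))⌉₊ < q :=
        Nat.lt_of_succ_le ((le_max_right _ _).trans hQq)
      have h4 : ((⌈Real.exp (2 * (weilPositivityThreshold - C))⌉₊ : ℕ) : ℝ) < q := by exact_mod_cast h3
      exact (Nat.le_ceil _).trans_lt h4
    exact absurd (hC q hq) (not_le.2 (wallOffset_lt_of_not_handoffStep hq₁ hfail h1 h2))

/-- **THE SIZE OF THE MARGIN DOOR**: a threshold-margin law `MARGIN(m)` implies RH as soon as `q ↦ m(q) + (log q)/2` is
UNBOUNDED ABOVE along the primes (then the walls `W(q) ≥ (log q)/2 + m(q)` are unbounded; file XII).  Sharpens theory-2's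
`riemannHypothesis_of_handoffMargin` (`m ≥ 0`): e.g. `m(q) = −0.49·log q` or any constant qualifies. [this track (theory-1)] -/
theorem riemannHypothesis_of_handoffMargin_of_unbounded (h : HandoffMargin m)
    (hm : ∀ B : ℝ, ∃ q : ℕ, q.Prime ∧ B ≤ m q + Real.log q / 2) : Summit.RiemannHypothesis := by
  refine riemannHypothesis_iff_forall_exists_prime_le_wall.2 fun T ↦ ?_
  obtain ⟨q, hq, hB⟩ := hm T
  exact ⟨q, hq, hB.trans (by have := h q hq; linarith)⟩

/-- **A CONSTANT margin law is RH whatever the sign of the constant**: for every `c ≤ 0`, `MARGIN(c) ↔ RH`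
(theory-2's `handoffMargin_zero_iff` is `c = 0`; for `c > 0`, `MARGIN(c) → RH` and the converse is not claimed).
[this track (theory-1); Yoshida1992HermitianForms, Prop. 6 (p. 320)] -/
theorem handoffMargin_const_iff (hc : c ≤ 0) : HandoffMargin (fun _ ↦ c) ↔ Summit.RiemannHypothesis := by
  constructor
  · intro h
    refine riemannHypothesis_of_handoffMargin_of_unbounded h fun B ↦ ?_
    obtain ⟨q, hQq, hq⟩ := Nat.exists_infinite_primes (⌈Real.exp (2 * (B - c))⌉₊ + 1)
    refine ⟨q, hq, ?_⟩
    have h0 : (0 : ℝ) < q := by exact_mod_cast hq.pos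
    have h1 : Real.exp (2 * (B - c)) < q := by
      have h2 : ((⌈Real.exp (2 * (B - c))⌉₊ : ℕ) : ℝ) < q := by exact_mod_cast Nat.lt_of_succ_le hQq
      exact (Nat.le_ceil _).trans_lt h2
    have h3 : 2 * (B - c) < Real.log q := by
      rw [Real.lt_log_iff_exp_lt h0]
      exact h1
    linarith
  · intro hRH
    exact handoffMargin_of_riemannHypothesis hRH fun _ _ ↦ hc

/-- Any constant margin law, of either sign, implies RH. [this track (theory-1)] -/
theorem riemannHypothesis_of_handoffMargin_const (c : ℝ) (h : HandoffMargin (fun _ ↦ c)) : Summit.RiemannHypothesis := by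
  rcases le_or_gt c 0 with hc | hc
  · exact (handoffMargin_const_iff hc).1 h
  · exact riemannHypothesis_of_handoffMargin (fun _ _ ↦ hc.le) h

/-- **`RH ↔ MARGIN(m)` for SOME bounded-below `m`** — the logical content of the slot E-1 toward RH is exactly
boundedness-below of the wall offsets. [this track (theory-1)] -/
theorem riemannHypothesis_iff_exists_handoffMargin_bddBelow :
    Summit.RiemannHypothesis ↔ ∃ m : ℕ → ℝ, (∃ C : ℝ, ∀ q : ℕ, q.Prime → C ≤ m q) ∧ HandoffMargin m := by
  constructor
  · intro hRH
    exact ⟨fun _ ↦ 0, ⟨0, fun _ _ ↦ le_rfl⟩, handoffMargin_zero_iff.2 hRH⟩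
  · rintro ⟨m, ⟨C, hC⟩, hm⟩
    refine riemannHypothesis_iff_wallOffset_bddBelow.2 ⟨C, fun q hq ↦ (hC q hq).trans ?_⟩
    exact (handoffMargin_iff_forall_le_wallOffset.1 hm) q hq

/-! ## §3 Instances: the first two primes move the wall (kernel) -/

/-- **`2` moves the wall**: `a*(∅) < a*({2})` (upper clause at `2` + the rung `H(2)`). [cite: Yoshida1992HermitianForms, Thm. 1 (p. 310); kernel wall certificate (tree, cc-s2-4)] -/
theorem wall_two_lt_wall_three :
    weilSemilocalThreshold (Nat.primesBelow 2) < weilSemilocalThreshold (Nat.primesBelow 3) := by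
  have h := wall_lt_wall_nextPrime_of_upperClause Nat.prime_two
    (by rw [nextPrime_two]; exact weilSemilocalThreshold_primesBelow_two_lt) handoffH_two
  rwa [nextPrime_two] at h

/-- **`3` moves the wall**: `a*({2}) < a*({2,3})` (upper clause at `3` + the THEOREM rung `H(3)` = `weilPositivityOn_log5half`).
[cite: Yoshida1992HermitianForms, Prop. 6 (p. 320); kernel wall certificate and rung (tree)] -/
theorem wall_three_lt_wall_five :
    weilSemilocalThreshold (Nat.primesBelow 3) < weilSemilocalThreshold (Nat.primesBelow 5) := by
  have h := wall_lt_wall_nextPrime_of_upperClause Nat.prime_three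
    (by rw [nextPrime_three]; exact weilSemilocalThreshold_primesBelow_three_lt) handoffH_three
  rwa [nextPrime_three] at h

/-- At least two primes move the wall (unconditional, kernel): witnesses `2` and `3`. [this track (theory-1)] -/
theorem two_primes_move_the_wall :
    ∃ p q : ℕ, p.Prime ∧ q.Prime ∧ p ≠ q ∧
      weilSemilocalThreshold (Nat.primesBelow p) < weilSemilocalThreshold (Nat.primesBelow (nextPrime p)) ∧
      weilSemilocalThreshold (Nat.primesBelow q) < weilSemilocalThreshold (Nat.primesBelow (nextPrime q)) := by
  refine ⟨2, 3, Nat.prime_two, Nat.prime_three, by decide, ?_, ?_⟩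
  · rw [nextPrime_two]; exact wall_two_lt_wall_three
  · rw [nextPrime_three]; exact wall_three_lt_wall_five

/-! ## §4 What a moving prime certifies (appended, theory-1 gen6): `W(q) ≠ W(q⁺) ⟹ WeilPositivityOn((log q)/2)` -/

/-- **Below a failed rung no prime moves the wall**: if Weil positivity fails on `C((log q)/2)` (`q` prime) then `W(q) = W(q⁺)` —
the onset `a₀` lies below `(log q)/2`, so BOTH walls are frozen at `a₀` (file XII `wall_eq_threshold_of_lt`).
[this track (theory-1); Yoshida1992HermitianForms, Prop. 6 (p. 320)] -/
theorem wall_eq_wall_nextPrime_of_not_weilPositivityOn (hq : q.Prime) (h : ¬ WeilPositivityOn (Real.log q / 2)) :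
    weilSemilocalThreshold (Nat.primesBelow q) = weilSemilocalThreshold (Nat.primesBelow (nextPrime q)) := by
  have hRH : ¬ Summit.RiemannHypothesis := fun hR ↦
    h (MotivicDoor.Rungs.rung_of_riemannHypothesis hR (log_half_pos_of_prime hq))
  obtain ⟨a₀, ha₀⟩ := exists_isWeilOnset_of_not_riemannHypothesis hRH
  have hlt : a₀ < Real.log q / 2 := by
    by_contra hle
    exact h ((ha₀.weilPositivityOn_iff (log_half_pos_of_prime hq)).2 (not_lt.1 hle))
  rw [ha₀.eq_weilPositivityThreshold] at hlt
  have hq' : Real.log q / 2 ≤ Real.log (nextPrime q) / 2 := by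
    have h0 : (0 : ℝ) < q := by exact_mod_cast hq.pos
    have h1 : (q : ℝ) ≤ nextPrime q := by exact_mod_cast (lt_nextPrime q).le
    linarith [Real.log_le_log h0 h1]
  rw [wall_eq_threshold_of_lt hRH hlt, wall_eq_threshold_of_lt hRH (hlt.trans_le hq')]

/-- **A PRIME THAT MOVES THE WALL CARRIES THE RUNG AT ITS OWN ENTRANCE** (RH-free, unconditional): `W(q) ≠ W(q⁺) → WeilPositivityOn((log q)/2)`,
i.e. «`q` moves the wall» implies `IH(q)` — the motion statement is CUMULATIVE in the sense of HANDOFF-STATEMENT §I.5 (its individual instances are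
at least rung-strength), while «`q` moves the wall» is NOT known to be RH-implied without the upper clause `UC(q)`; only its INFINITUDE is RH
(`riemannHypothesis_iff_wall_moves_io`). [this track (theory-1)] -/
theorem weilPositivityOn_of_wall_ne (hq : q.Prime)
    (h : weilSemilocalThreshold (Nat.primesBelow q) ≠ weilSemilocalThreshold (Nat.primesBelow (nextPrime q))) :
    WeilPositivityOn (Real.log q / 2) := by
  by_contra hW
  exact h (wall_eq_wall_nextPrime_of_not_weilPositivityOn hq hW)

/-- `WeilPositivityOn((log q)/2) → (log q)/2 ≤ W(q)` for a prime `q` (below the window of `q` the `S_q`-form IS Weil's form). [folklore] -/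
theorem log_half_le_wall_of_weilPositivityOn (hq : q.Prime) (hW : WeilPositivityOn (Real.log q / 2)) :
    Real.log q / 2 ≤ weilSemilocalThreshold (Nat.primesBelow q) := by
  have hS : ∀ n ≤ q - 1, IsPrimePow n → n.primeFactors ⊆ Nat.primesBelow q := fun n hn _ ↦ by
    have := primeFactors_subset_primesBelow hn
    rwa [Nat.sub_add_cancel hq.one_lt.le] at this
  have e : Real.log (((q - 1 : ℕ) : ℝ) + 1) / 2 = Real.log q / 2 := by
    rw [show ((q - 1 : ℕ) : ℝ) + 1 = q by exact_mod_cast Nat.sub_add_cancel hq.one_lt.le]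
  have h1 := (weilSemilocalPositivityOn_iff_weilPositivityOn_of_forall hS).2
  rw [e] at h1
  exact le_weilSemilocalThreshold (h1 hW)

/-- In wall-offset currency: `W(q) ≠ W(q⁺) → 0 ≤ δ*(q)`. [this track (theory-1)] -/
theorem wallOffset_nonneg_of_wall_ne (hq : q.Prime)
    (h : weilSemilocalThreshold (Nat.primesBelow q) ≠ weilSemilocalThreshold (Nat.primesBelow (nextPrime q))) :
    0 ≤ wallOffset q := by
  rw [wallOffset, sub_nonneg]
  exact log_half_le_wall_of_weilPositivityOn hq (weilPositivityOn_of_wall_ne hq h)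

/-- For consecutive primes `p < q`: if `q` moves the wall then `H(p)` holds (`H(p) = WeilPositivityOn((log q)/2)`). So under `¬RH` with failing
prime `q₁`, no prime `> q₁` moves the wall (§1) and — by this lemma read contrapositively — nothing is asserted at `q₁` itself. [this track (theory-1)] -/
theorem handoffH_of_wall_ne_nextPrime {p : ℕ} (hp : p.Prime)
    (h : weilSemilocalThreshold (Nat.primesBelow (nextPrime p)) ≠
      weilSemilocalThreshold (Nat.primesBelow (nextPrime (nextPrime p)))) : HandoffH p :=
  (handoffH_iff_weilPositivityOn hp).2 (weilPositivityOn_of_wall_ne (nextPrime_prime p) h)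

/-! ## §5 Tail forms under an eventual upper clause (appended, theory-1 gen8)

The RH-free upper clause FROM A PRIME `Q` ON — `∀ q ≥ Q prime, W(q) < (log q⁺)/2` — is a named hypothesis below; the cell's intended
dischargers are prove-2's `HandoffDodgerUpperClause.upperClause_eventually_of_dodgerWallCeiling` (from the typed RH-free target
`DodgerWallCeiling C q₀`, ATTEMPT-15 — not a theorem) and, behind Cramér-size gaps only, `HandoffWallCeiling.wall_lt_log_half_of_large_gap`.
Nothing here bears on the truth of RH: every statement is RH itself modulo that hypothesis, or concerns `¬RH`-worlds. -/

/-- RH-free half, NO upper clause needed: **if every prime `≥ Q` moves the wall, then RH** (infinitely many movers suffice, §1).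
[this track (theory-1); Yoshida1992HermitianForms, Prop. 6 (p. 320); Bombieri2000Weil, Thm. 2] -/
theorem riemannHypothesis_of_forall_ge_wall_ne (Q : ℕ)
    (h : ∀ q ≥ Q, q.Prime →
      weilSemilocalThreshold (Nat.primesBelow q) ≠ weilSemilocalThreshold (Nat.primesBelow (nextPrime q))) :
    Summit.RiemannHypothesis := by
  refine riemannHypothesis_iff_wall_moves_io.2 fun Q' ↦ ?_
  obtain ⟨q, hq, hqp⟩ := Nat.exists_infinite_primes (max Q Q')
  exact ⟨q, (le_max_right _ _).trans hq, hqp, h q ((le_max_left _ _).trans hq) hqp⟩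

/-- **Under the upper clause from `Q` on, `RH ↔ every prime `≥ Q` STRICTLY RAISES the wall`** (`W(q) < W(q⁺)` for all primes `q ≥ Q`).
(⇒) `RH → H(q)`, and `UC(q) ∧ H(q) → W(q) < (log q⁺)/2 ≤ W(q⁺)`; (⇐) `riemannHypothesis_of_forall_ge_wall_ne`. The tail twin of §1's
`riemannHypothesis_iff_forall_wall_lt_of_upperClause`. [this track (theory-1)] -/
theorem riemannHypothesis_iff_forall_ge_wall_lt_of_upperClause (Q : ℕ)
    (hUC : ∀ q ≥ Q, q.Prime → weilSemilocalThreshold (Nat.primesBelow q) < Real.log (nextPrime q) / 2) :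
    Summit.RiemannHypothesis ↔
      ∀ q ≥ Q, q.Prime →
        weilSemilocalThreshold (Nat.primesBelow q) < weilSemilocalThreshold (Nat.primesBelow (nextPrime q)) :=
  ⟨fun hRH q hQ hq ↦
      wall_lt_wall_nextPrime_of_upperClause hq (hUC q hQ hq) (riemannHypothesis_iff_forall_handoffH.1 hRH q hq),
    fun h ↦ riemannHypothesis_of_forall_ge_wall_ne Q fun q hQ hq ↦ (h q hQ hq).ne⟩

/-- **Under the upper clause from `Q` on, `RH ↔ EVERY prime `≥ Q` MOVES the wall`** (`W(q) ≠ W(q⁺)`): the rate-free criterion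
«infinitely many primes move the wall» (§1, `riemannHypothesis_iff_wall_moves_io`) sharpens to «all primes from `Q` on» exactly when a tail
upper clause is available. [this track (theory-1)] -/
theorem riemannHypothesis_iff_forall_ge_wall_ne_of_upperClause (Q : ℕ)
    (hUC : ∀ q ≥ Q, q.Prime → weilSemilocalThreshold (Nat.primesBelow q) < Real.log (nextPrime q) / 2) :
    Summit.RiemannHypothesis ↔
      ∀ q ≥ Q, q.Prime →
        weilSemilocalThreshold (Nat.primesBelow q) ≠ weilSemilocalThreshold (Nat.primesBelow (nextPrime q)) :=
  ⟨fun hRH q hQ hq ↦ ((riemannHypothesis_iff_forall_ge_wall_lt_of_upperClause Q hUC).1 hRH q hQ hq).ne,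
    riemannHypothesis_of_forall_ge_wall_ne Q⟩

/-- Under a failed increment at `q₁` (`¬RH`) and the upper clause from `Q` on: **every prime `q` with `Q ≤ q < q₁` strictly raises the
wall** (`H(q)` holds below the failing prime, `handoffH_iff_lt_of_not_handoffStep`), while no prime `> q₁` moves it (§1,
`wall_eq_wall_nextPrime_of_not_handoffStep`) — the movers from `Q` on are the primes of `[Q, q₁)` plus possibly `q₁` itself (undecided:
`IH(q₁)` holds, `H(q₁)` fails). [this track (theory-1); Yoshida1992HermitianForms, Prop. 6 (p. 320)] -/
theorem wall_lt_wall_nextPrime_of_lt_of_not_handoffStep (hq₁ : q₁.Prime) (hfail : ¬ HandoffStep q₁) (Q : ℕ)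
    (hUC : ∀ q ≥ Q, q.Prime → weilSemilocalThreshold (Nat.primesBelow q) < Real.log (nextPrime q) / 2)
    (hQ : Q ≤ q) (hq : q.Prime) (hlt : q < q₁) :
    weilSemilocalThreshold (Nat.primesBelow q) < weilSemilocalThreshold (Nat.primesBelow (nextPrime q)) :=
  wall_lt_wall_nextPrime_of_upperClause hq (hUC q hQ hq) ((handoffH_iff_lt_of_not_handoffStep hq₁ hfail hq).2 hlt)

end Summit.RiemannHypothesis.RiemannHypothesis.Theorems.HandoffDecomposition

end
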